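import Mathlib.Topology.Instances.ZMod
import Mathlib.MeasureTheory.MeasurableSpace.Instances
import Mathlib.MeasureTheory.Constructions.BorelSpace.Basic
import Mathlib.Combinatorics.SimpleGraph.Paths
import Literature.MathematicalPhysics.QuantumLattice.GaugeGroups
import Literature.MathematicalPhysics.QuantumLattice.LatticeGaugeDLR
import Literature.MathematicalPhysics.QuantumLattice.WilsonLoops
import Literature.Probability.LatticeModels.LatticeGraph
import HarnessLib

-- provenance: harness21/H21/H21/Statements/ConstructiveQFT/LatticeGaugeAsymptotics.lean @ 3cd5f34 (interim HEAD d8f2665); M5 mechanical rewrite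
/-!
# Weak-coupling asymptotics of lattice gauge theory (Chatterjee)

Trunk G13 (`QLatticeAQFT`), family `constructive-qft`, statements file
`ConstructiveQFT/LatticeGaugeAsymptotics.lean` (split off `LatticeGauge.lean`, review F15f).
Two theorems of S. Chatterjee on Wilson lattice gauge theory as `β → ∞`:

* **constructive-qft.S17** `chatterjee_freeEnergyDensity`: for `U(N)` lattice gauge theory on
  `ℤ⁴` the free energy density `f(β) = lim |Λ|⁻¹ log Z_{Λ, β}` exists for every `β` and
  `f(β) - c log β → K` as `β → ∞` for explicit constants `c`, `K` (S. Chatterjee, *The leading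
  term of the Yang–Mills free energy*, J. Funct. Anal. 271 (2016) 2944–3005, arXiv:1602.01222,
  Thm. 1.1).
* **constructive-qft.S18** `chatterjee_z2_wilsonLoops`: in `4`-dimensional `ℤ₂` (Ising) lattice
  gauge theory at large `β`, the Wilson loop expectation of a self-avoiding loop of length `ℓ`
  with `ℓ₀` corners satisfies `|⟨W_γ⟩ - exp (-2 ℓ e^{-12 β})| ≤ C₁ (e^{-2β} + √(ℓ₀/ℓ))^{C₂}`
  (S. Chatterjee, *Wilson loops in Ising lattice gauge theory*, Comm. Math. Phys. 377 (2020)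
  307–340, arXiv:1811.09770, Thm. 1.1).

## Relation to `Literature.Statements.ConstructiveQFT.Sweep1`

The earlier sweep file `Sweep1.lean` states both results in a self-contained ad hoc setting
(`Literature.MathematicalPhysics.QuantumFieldTheory.chatterjee_freeEnergy`: joint limit `n → ∞`, `g₀ → 0` of the free energy
per site on free-boundary cubes, with Chatterjee's constants typed;
`Literature.MathematicalPhysics.QuantumFieldTheory.chatterjee_isingGauge_wilsonLoop`: rectangular loops only, free-boundary box
limits). The present file restates them on top of the accepted A9/A10 prelude API (torus states,
DLR/infinite-volume limit points, `SimpleGraph.Walk` loops with `numCorners`); the two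
formalisations are genuinely different statements, so the declarations here carry different
names (`chatterjee_freeEnergyDensity`, `chatterjee_z2_wilsonLoops`) and this file does not import
`Sweep1` (no shared declaration names).

## Design choices and faithfulness flags (outline R5)

* Both statements are phrased with the A9/A10 prelude API: `HasFreeEnergyDensity`,
  `freeEnergyDensity` (free energy per site along the tori `(ℤ/(L+1)ℤ)^d`, Wave 0 normalisation
  of the Wilson action `S = ∑ₚ (N - Re tr ρ(U_p))`), `infiniteVolumeLimitPoints ρ β`
  (subsequential infinite-volume limits of torus Wilson states), `loopExpectation`, `numCorners`.
  Chatterjee works with free boundary conditions on cubes `{0, …, n-1}^d`; the free energy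
  density is boundary-condition independent, and the Wilson-loop asymptotics are stated here for
  torus limit points — **flagged** (boundary conditions).
* S17: Chatterjee's weight is `exp (-β S_Λ)` with `S_Λ = ∑ₚ Re Tr (I - U_p)` (`β = 1/g₀²`), which
  is exactly Wave 0's normalisation of the Wilson action (minimum `0`), so the leading behaviour
  is `c log β + K`. The statement only asserts `∃ c K, f(β) - c log β → K`; Chatterjee's explicit
  values (his Thm. 1.1, transcribed, **not re-verified against the printed display — flagged**)
  are quoted in the docstring of `chatterjee_freeEnergyDensity` and are not typed (they are typed
  in the `Sweep1` cube version). Only the `U(N)` case (the one treated in the paper) is asserted;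
  dimension is fixed to `d = 4` as in the inventory text (the paper treats general `d`). No
  hypothesis `1 ≤ N` is imposed: for `N = 0` the weakened statement holds trivially, and Mathlib
  style forbids unused hypotheses (review item 2).
* S18: Chatterjee's error term `C₁ (e^{-2β} + √(ℓ₀/ℓ))^{C₂}` (`ℓ` = length, `ℓ₀` = number of
  corner edges) is transcribed as the local definition `errorTerm β ℓ ℓ₀ = e^{-2β} + √(ℓ₀/ℓ)`,
  raised to the power `C₂` in the statement. Chatterjee counts *corner edges* whereas the prelude
  `numCorners` counts direction changes of the walk; every corner edge is adjacent to a direction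
  change and every direction change touches at most two corner edges, so the two counts differ by
  a factor `≤ 2`, which is absorbed into `C₁` (`(a + √(2x))^{C₂} ≤ 2^{C₂/2} (a + √x)^{C₂}`) —
  **flagged** (corner convention). Loops are Mathlib `SimpleGraph.Walk.IsCycle` closed walks in
  `zdGraph 4` (Chatterjee allows generalized non-self-intersecting loops; cycles are a sub-case);
  the `ℤ₂` Wilson loop variable is `χ = normalisedCharacter 1 ∘ z2Rep = ±1`.
* Non-vacuity of the quantifier over `μ ∈ infiniteVolumeLimitPoints z2Rep β`:
  `Literature.MathematicalPhysics.QuantumLattice.infiniteVolumeLimitPoints_nonempty` (file `LatticeGaugeDLR.lean`; compactness), which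
  applies since `ℤ₂` is a compact second-countable group and `z2Rep` is continuous (discrete
  topology); see `infiniteVolumeLimitPoints_z2Rep_nonempty` below. Quantifying over all torus
  limit points is legitimate because Chatterjee's bounds are uniform finite-volume bounds.
* To speak of measures on `LGConfig 4 (Multiplicative (ZMod 2))` we need a `MeasurableSpace` /
  `BorelSpace` structure on `Multiplicative (ZMod 2)`. Mathlib equips `ZMod n` with the discrete
  topology (`Mathlib.Topology.Instances.ZMod`) and the `⊤` σ-algebra
  (`ZMod.instMeasurableSpace`), and transfers the topology (but not the σ-algebra) to
  `Multiplicative`; we add the two missing transfer instances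
  `Multiplicative.instMeasurableSpace`, `Multiplicative.instMeasurableSingletonClass`
  (deliberately in Mathlib's `Multiplicative` namespace, mirroring
  `Mathlib.Topology.Constructions`; they duplicate no existing instance), after which
  `BorelSpace` follows from Mathlib's `Countable.instBorelSpace`. They are general-purpose and
  the supervisor may move them verbatim to `Prelude/QLatticeAQFT/GaugeGroups.lean` next to
  `z2Rep` (review item 3, outline R9); no accepted H21 module declares them at present.

## Mathlib status

No lattice gauge theory in Mathlib (see the A9 module docstring). Anchors used: `Filter.Tendsto`,
`Filter.atTop`, `Real.log`, `Real.exp`, `SimpleGraph.Walk.IsCycle`, `SimpleGraph.Walk.length`,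
`Matrix.unitaryGroup`, `Multiplicative`, `ZMod`, `Countable.instBorelSpace`.

## References

* S. Chatterjee, *The leading term of the Yang–Mills free energy*, J. Funct. Anal. 271 (2016)
  2944–3005, arXiv:1602.01222, Thm. 1.1.
* S. Chatterjee, *Wilson loops in Ising lattice gauge theory*, Comm. Math. Phys. 377 (2020)
  307–340, arXiv:1811.09770, Thm. 1.1.
* S. Cao, *Wilson loop expectations in lattice gauge theories with finite gauge groups*,
  Comm. Math. Phys. 380 (2020) 1439–1505, Thm. 1.1.
* C. Brennecke, arXiv:2511.07297, Thm. 2 (the constant `K_d`).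
* E. Seiler, LNP 159 (1982), Ch. 2 (free energy, boundary conditions).
-/

noncomputable section

/-! ### Measurable structure on `Multiplicative X` -/

/-- Transfer the σ-algebra of `X` to `Multiplicative X` (the identity transfer, exactly as
`Mathlib.Topology.Constructions` transfers the topology). Needed to speak of measures on
`ℤ₂ = Multiplicative (ZMod 2)`-valued lattice gauge configurations (Chatterjee, CMP 377 (2020)
§1). Deliberately placed in Mathlib's `Multiplicative` namespace; Mathlib has no such instance. [folklore] -/
instance Multiplicative.instMeasurableSpace {X : Type*} [MeasurableSpace X] :
    MeasurableSpace (Multiplicative X) :=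
  ‹MeasurableSpace X›

/-- Singletons of `Multiplicative X` are measurable when those of `X` are (identity transfer);
with the discrete topology this makes `Multiplicative (ZMod n)` a `BorelSpace` via Mathlib's
`Countable.instBorelSpace` (Chatterjee, CMP 377 (2020) §1, `ℤ₂` gauge group). [folklore] -/
instance Multiplicative.instMeasurableSingletonClass {X : Type*} [MeasurableSpace X]
    [MeasurableSingletonClass X] : MeasurableSingletonClass (Multiplicative X) :=
  ‹MeasurableSingletonClass X›

open MeasureTheory Filter Topology SimpleGraph
open Literature.Probability.LatticeModels Literature.MathematicalPhysics.QuantumLattice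

namespace Literature.MathematicalPhysics.QuantumFieldTheory

/-! ### constructive-qft.S17: the leading term of the Yang–Mills free energy -/

/-- **constructive-qft.S17** (S. Chatterjee, *The leading term of the Yang–Mills free energy*,
J. Funct. Anal. 271 (2016) 2944–3005, arXiv:1602.01222, Thm. 1.1; Seiler LNP 159 Ch. 2 for the
existence of the free energy; Brennecke arXiv:2511.07297 Thm. 2 for `K_d`).

For `U(N)` Wilson lattice gauge theory on `ℤ⁴` (fundamental representation
`unitaryFundamentalRep (Fin N) ℂ`, Wave 0 action `S = ∑ₚ (N - Re tr U_p)`), (i) the free energy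
density per site `f(β) = lim_{L → ∞} (L+1)^{-4} log Z_{(ℤ/(L+1)ℤ)^4, β}` exists for every `β`, and
(ii) there are constants `c K : ℝ` with `f(β) - c log β → K` as `β → ∞`.

Chatterjee's explicit constants (weight `exp (-β ∑ₚ Re Tr (I - U_p))`, the same normalisation
as Wave 0's; free boundary conditions on cubes, general dimension `d ≥ 2`; quoted, **not typed
and not re-verified against the printed display — flagged R5**):
`lim_{β → ∞} (F_d(β) + ((d-1) N² / 2) log β) = (d-1) log (∏_{j=1}^{N-1} j! / (2π)^{N/2}) + N² K_d`,
where `K_d` is an explicit lattice-Gaussian (discrete massless free field) constant; so here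
`c = -(d-1)N²/2 = -3N²/2`. The typed constants appear in the cube/joint-limit version
`Literature.MathematicalPhysics.QuantumFieldTheory.chatterjee_freeEnergy` of `Sweep1.lean`, a different formalisation of the
same result. Chatterjee assumes `N ≥ 1`; for `N = 0` this weakened statement holds trivially, so
no hypothesis on `N` is imposed. [cite: arXiv160201222] -/
def chatterjee_freeEnergyDensity : Prop :=
  ∀ (N : ℕ),
    (∀ β : ℝ, HasFreeEnergyDensity 4 (unitaryFundamentalRep (Fin N) ℂ) β
        (freeEnergyDensity 4 (unitaryFundamentalRep (Fin N) ℂ) β)) ∧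
      ∃ c K : ℝ, Tendsto
        (fun β : ℝ => freeEnergyDensity 4 (unitaryFundamentalRep (Fin N) ℂ) β - c * Real.log β)
        atTop (𝓝 K)

/-! ### constructive-qft.S18: Wilson loops in `4`-dimensional `ℤ₂` lattice gauge theory -/

/-- The `ℤ₂` Wilson loop variable: the character `χ(a) = (-1)^a ∈ {±1}` of
`ℤ₂ = Multiplicative (ZMod 2)`, written as `normalisedCharacter 1 ∘ z2Rep` so that
`W_γ(U) = χ(∏_{e ∈ γ} U_e) = ∏_{e ∈ γ} (-1)^{U_e}` (Chatterjee, CMP 377 (2020) §1.1). [folklore] -/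
def z2Character : Multiplicative (ZMod 2) → ℝ :=
  normalisedCharacter 1 ∘ z2Rep

/-- `z2Character a = (-1)^a`. [folklore] -/
theorem z2Character_apply (a : Multiplicative (ZMod 2)) :
    z2Character a = (-1 : ℝ) ^ a.toAdd.val := by
  simp only [z2Character, Function.comp_apply, z2Rep_apply, normalisedCharacter, Nat.cast_one,
    inv_one, one_mul, Matrix.trace_smul, Matrix.trace_one, Fintype.card_fin, smul_eq_mul, mul_one]
  rw [show (-1 : ℂ) = ((-1 : ℝ) : ℂ) by norm_num, ← Complex.ofReal_pow, Complex.ofReal_re]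

/-- Chatterjee's leading term `exp (-2 ℓ e^{-12 β})` for the expectation of a Wilson loop of length
`ℓ` in `4`-dimensional `ℤ₂` lattice gauge theory at inverse coupling `β`: each edge of the loop
independently carries a minimal vortex (six excited plaquettes, weight `e^{-12β}`) flipping the
sign of `W_γ` (Chatterjee, CMP 377 (2020) Thm. 1.1 and §1.2). [folklore] -/
def z2WilsonMainTerm (β : ℝ) (ℓ : ℕ) : ℝ :=
  Real.exp (-2 * ℓ * Real.exp (-12 * β))

/-- The main term is positive. [folklore] -/
theorem z2WilsonMainTerm_pos (β : ℝ) (ℓ : ℕ) : 0 < z2WilsonMainTerm β ℓ :=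
  Real.exp_pos _

/-- The main term is at most `1` (the exponent is non-positive). [folklore] -/
theorem z2WilsonMainTerm_le_one (β : ℝ) (ℓ : ℕ) : z2WilsonMainTerm β ℓ ≤ 1 := by
  refine Real.exp_le_one_iff.2 ?_
  have h₁ : (0 : ℝ) ≤ ℓ := Nat.cast_nonneg ℓ
  have h₂ : 0 < Real.exp (-12 * β) := Real.exp_pos _
  nlinarith

/-- Chatterjee's error term base `e^{-2β} + √(ℓ₀/ℓ)` for a loop of length `ℓ` with `ℓ₀` corners
at inverse coupling `β`; Thm. 1.1 of Chatterjee, CMP 377 (2020) bounds the deviation of `⟨W_γ⟩`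
from the main term by `C₁ (errorTerm β ℓ ℓ₀)^{C₂}`. Junk value: for `ℓ = 0` the quotient `ℓ₀/ℓ`
is `0` by the division convention; the statement below only uses cycles (`ℓ ≥ 3`). [folklore] -/
def errorTerm (β : ℝ) (ℓ ℓ₀ : ℕ) : ℝ :=
  Real.exp (-2 * β) + Real.sqrt (ℓ₀ / ℓ)

/-- The error term base is nonnegative (so real powers `errorTerm β ℓ ℓ₀ ^ C₂` behave well). [folklore] -/
theorem errorTerm_nonneg (β : ℝ) (ℓ ℓ₀ : ℕ) : 0 ≤ errorTerm β ℓ ℓ₀ :=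
  add_nonneg (Real.exp_pos _).le (Real.sqrt_nonneg _)

/-- The error term base is at least `e^{-2β} > 0`. [folklore] -/
theorem exp_le_errorTerm (β : ℝ) (ℓ ℓ₀ : ℕ) : Real.exp (-2 * β) ≤ errorTerm β ℓ ℓ₀ :=
  le_add_of_nonneg_right (Real.sqrt_nonneg _)

/-- Non-vacuity of the state quantifier in `chatterjee_z2_wilsonLoops`: the set of
infinite-volume torus limit points of `4`-dimensional `ℤ₂` lattice gauge theory is non-empty for
every `β` (compactness; `Literature.MathematicalPhysics.QuantumLattice.infiniteVolumeLimitPoints_nonempty`, `ℤ₂` being a finite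
discrete group and `z2Rep` continuous). [folklore] -/
def infiniteVolumeLimitPoints_z2Rep_nonempty : Prop :=
  ∀ (β : ℝ),
    (infiniteVolumeLimitPoints (d := 4) z2Rep β).Nonempty

/- interim proof relied on results that are now named facts (D-0014); demoted to a fact by the M5 import, proof preserved:
:=
  infiniteVolumeLimitPoints_nonempty _ continuous_of_discreteTopology β
-/

/-- **constructive-qft.S18** (S. Chatterjee, *Wilson loops in Ising lattice gauge theory*, Comm.
Math. Phys. 377 (2020) 307–340, arXiv:1811.09770, Thm. 1.1; S. Cao, Comm. Math. Phys. 380 (2020)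
Thm. 1.1 for general finite gauge groups).

Wilson loops in `4`-dimensional `ℤ₂` lattice gauge theory at weak coupling: there are `β₀` and
constants `C₁, C₂ > 0` such that for all `β ≥ β₀`, every infinite-volume limit state
`μ ∈ infiniteVolumeLimitPoints z2Rep β` on `ℤ⁴` (a non-empty set,
`infiniteVolumeLimitPoints_z2Rep_nonempty`), and every self-avoiding lattice loop `γ`
(`SimpleGraph.Walk.IsCycle`) of length `ℓ` with `ℓ₀` corners,
`|⟨W_γ⟩_μ - exp (-2 ℓ e^{-12 β})| ≤ C₁ (e^{-2β} + √(ℓ₀/ℓ))^{C₂}`.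

Faithfulness flags (R5): Chatterjee's `ℓ₀` counts corner *edges*, here `numCorners w` counts
direction changes (factor `≤ 2`, absorbed into `C₁`); Chatterjee's states are free-boundary
limits on cubes, torus limit points are used here (his finite-volume bounds are uniform in the
volume and the boundary condition); his loops are generalized non-self-intersecting loops of
length `≥ 4`, restricted here to graph cycles. [cite: arXiv181109770] -/
def chatterjee_z2_wilsonLoops : Prop :=
  ∃ β₀ C₁ C₂ : ℝ, 0 < C₁ ∧ 0 < C₂ ∧ ∀ β : ℝ, β₀ ≤ β →
      ∀ μ ∈ infiniteVolumeLimitPoints (d := 4) z2Rep β,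
        ∀ (x : Literature.Probability.LatticeModels.Site 4) (w : (zdGraph 4).Walk x x), w.IsCycle →
          |loopExpectation μ z2Character w - z2WilsonMainTerm β w.length| ≤
            C₁ * errorTerm β w.length (numCorners w) ^ C₂

end Literature.MathematicalPhysics.QuantumFieldTheory
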